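import Summits.QuantumFields.YangMills.Theorems.AtomicSynthesisMolliApprox
import Mathlib
import HarnessLib

/-!
# LINE «FemtoWitness» v6 on crux ⟨stmt-QuantumFields-23138⟩ `OnsetSkewLaw.RPOnsetFloor` (planner ym-idea-11 g13/g14): the registered stub
# `stub_singleSlot : StubSingleSlotP` BY NAME AND SIGNATURE

The single-slot fixed-father-bump atomic synthesis on `ℝ⁴` — the shared L stub of AtomicSynthesis ⟨28126⟩ and of the onset-floor lines on
⟨23138⟩ / ⟨22956⟩ — is the tree theorem ✓`Summit.QuantumFields.YangMills.Cruxes.AtomicSynthesis.SingleSlotPlan.stub_singleSlot`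
(`AtomicSynthesisMolliApprox`: H1 `momentKilling` + H4a `molliApprox` + H4b `riemannDisc_six` + H5/H4-split `stubSingleSlot_of_split`).
This file records it under the registered name for the ⟨23138⟩ registry (signature `RPOnsetFloorPosTimeSynthCollar.StubSingleSlotP`).

Tree only; no `sorry`; standard axioms.  HONEST FRAMING: one registered stub of an open line; `stub_onsetFloorQ2`, `stub_weakTwoPointCurrency`,
the crux 23138, every rung and summit statement are untouched; the Yang–Mills mass gap is NOT proved.  Width seat `ym-line-sfw-p2-w3` g36. [folklore]
-/

set_option autoImplicit false

namespace Summit.QuantumFields.YangMills.Theorems.RPOnsetFloorSingleSlotRegistered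

/-- **Registered stub `stub_singleSlot` of LINE «FemtoWitness» (⟨23138⟩), BY NAME AND SIGNATURE** — single-slot synthesis for every compactly
supported Schwartz father bump with non-zero integral (the tree theorem `AtomicSynthesis.SingleSlotPlan.stub_singleSlot`). [folklore] -/
theorem stub_singleSlot : Summit.QuantumFields.YangMills.Theorems.RPOnsetFloorPosTimeSynthCollar.StubSingleSlotP :=
  Summit.QuantumFields.YangMills.Cruxes.AtomicSynthesis.SingleSlotPlan.stub_singleSlot

end Summit.QuantumFields.YangMills.Theorems.RPOnsetFloorSingleSlotRegistered
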